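import Literature.NumberTheory.GaloisRepresentations.WeilDeligneOfGaloisExistence
import Literature.NumberTheory.GaloisRepresentations.WeilDeligneOfGaloisUnramifiedProofs
import Literature.NumberTheory.GaloisRepresentations.WeilDeligneRepLadicProofs
import Literature.NumberTheory.GaloisRepresentations.LAdicCharacterUnramifiedAEProofs
import Literature.NumberTheory.GaloisRepresentations.LocalField
import Literature.NumberTheory.GaloisRepresentations.TameInertia
import Literature.NumberTheory.Automorphic.LParameter
import HarnessLib

/-!
# The Grothendieck–Deligne existence fact from the PROVED `ℓ`-adic ↦ Weil–Deligne dictionary and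
# one character of inertia
(crux stmt-Langlands-14329 `IrreducibilityBySelfDuality.IrreducibleOffSector`, supports kit
`square-integrable-place`: the kit's input `ExistsWeilDeligneOfLadic` = the corollary
`GrothendieckDeligne_exists_isWeilDeligneOfLadic.toLocal` of the Literature named fact
`GrothendieckDeligne_exists_isWeilDeligneOfLadic`; `--supports` file, lead a1)

The named fact `GrothendieckDeligne_exists_isWeilDeligneOfLadic` (Literature, UNPROVED) differs from
the PROVED dictionary `exists_weilDeligneRep_of_ladic_holds` (Grothendieck–Deligne for a continuous
`ρ : W_F →ₜ* GL_n(E)`, `‖q‖ = 1`) only by (a) the passage `Γ_F →ₜ* GL_n(ℚ̄_ℓ)` ↦ `W_F →ₜ* GL_n(ℚ̄_ℓ)`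
(continuity of `W_F → Γ_F`, PROVED: `WeilGroup.continuous_toAbsGalois_holds`), (b) `‖q‖_ℓ = 1` for
`ℓ ≠ p` (`PadicAlgCl.norm_natCast_eq_one_of_not_dvd`, `residueFieldCard_eq_pow_ringChar`), and
(c) the NON-TRIVIALITY clause `∃ u ∈ U, t u ≠ 1` of `IsWeilDeligneOfLadic`, which the proved
dictionary does not supply (its `t` is read off `ρ` and vanishes when `ρ(U) = 1`).  This file proves
the fact from (c) alone, in the weakest form: on every open subgroup `U` of `I_F` SOME abstract
character `I_F →* Multiplicative ℚ̄_ℓ` is non-trivial (`grothendieckDeligne_exists_isWeilDeligneOfLadic_of_exists_character`).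
When the proved `t` is non-trivial on `U` nothing is needed; otherwise `ρ(U) = 1`, and `(ρ|_{W_F}, 0)`
is attached through ANY character non-trivial on `U` (`IsWeilDeligneOfLadic.of_N_eq_zero`).  The
remaining input is the `ℓ`-adic tame character `t_ℓ : I_F ↠ ℤ_ℓ(1)` (Serre 1972 §1.3), not yet in
the tree.
References: Deligne, Antwerp II §8.4.2; Tate, Corvallis 1979, (4.2.1); Serre–Tate 1968, Appendix;
Serre, Invent. Math. 15 (1972), §1.3.
-/

noncomputable section

set_option linter.dupNamespace false

open scoped MatrixGroups Matrix NumberField ValuativeRel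
open Module IsDedekindDomain
open Literature.NumberTheory.GaloisRepresentations
open Literature.NumberTheory.GaloisRepresentations.IsNonarchimedeanLocalField

namespace Summit.Langlands.Langlands.Theorems.IrreducibleOffSector.SquareIntegrablePlace

/-- **Grothendieck–Deligne existence, from one character of inertia per open subgroup.**  If for
every non-archimedean local field `F` of residue characteristic `≠ ℓ` and every open subgroup `U` of
`I_F` some homomorphism `t : I_F →* Multiplicative ℚ̄_ℓ` is non-trivial on `U`, then the named fact
`GrothendieckDeligne_exists_isWeilDeligneOfLadic` holds (everything else is the PROVED dictionary
`exists_weilDeligneRep_of_ladic_holds`). [cite: DeligneAntwerpII1973, §8.4.2]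
[cite: TateCorvallis1979, (4.2.1)] [cite: SerreTate1968, Appendix] -/
theorem grothendieckDeligne_exists_isWeilDeligneOfLadic_of_exists_character
    (hT : ∀ (F : Type) [Field F] [ValuativeRel F] [TopologicalSpace F] [IsNonarchimedeanLocalField F]
      (ℓ : ℕ) [Fact ℓ.Prime], ringChar 𝓀[F] ≠ ℓ →
      ∀ (U : Subgroup (WeilGroup F)), U ≤ WeilGroup.inertia F → IsOpen (U : Set (WeilGroup F)) →
        ∃ (t : WeilGroup.inertia F →* Multiplicative (PadicAlgCl ℓ)) (u : WeilGroup.inertia F),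
          (u : WeilGroup F) ∈ U ∧ t u ≠ 1) :
    GrothendieckDeligne_exists_isWeilDeligneOfLadic := by
  intro F _ _ _ _ ℓ _ hℓ n ρ
  -- (a) restriction of `ρ` to the Weil group, a continuous framed representation
  let ρW : FramedRep (WeilGroup F) (PadicAlgCl ℓ) n :=
    { toMonoidHom := ρ.toWeilGroupHom
      continuous_toFun := (map_continuous ρ).comp (WeilGroup.continuous_toAbsGalois_holds F) }
  have hρW : (ρW : WeilGroup F →* GL (Fin n) (PadicAlgCl ℓ)) = ρ.toWeilGroupHom := rfl
  -- (b) `‖q‖ = 1` in `ℚ̄_ℓ`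
  obtain ⟨f, -, hq⟩ := residueFieldCard_eq_pow_ringChar (F := F)
  have hnorm : ‖(residueFieldCard F : PadicAlgCl ℓ)‖ = 1 := by
    rw [hq, Nat.cast_pow, norm_pow, PadicAlgCl.norm_natCast_eq_one_of_not_dvd, one_pow]
    intro hdvd
    exact hℓ ((Nat.prime_dvd_prime_iff_eq Fact.out (ringChar_residueField_prime (F := F))).mp
      hdvd).symm
  -- the PROVED dictionary
  obtain ⟨r, t, U, Φ, hU, hUo, hΦ, h2, h3⟩ :=
    exists_weilDeligneRep_of_ladic_holds (F := F) (E := PadicAlgCl ℓ) (n := n) hnorm ρW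
  by_cases hne : ∃ u : WeilGroup.inertia F, (u : WeilGroup F) ∈ U ∧ t u ≠ 1
  · exact ⟨r, t, U, Φ, hU, hUo, hΦ, hne, h2, h3⟩
  · -- (c) `t` is trivial on `U`, so `ρ(U) = 1`: attach `(ρ|_{W_F}, 0)` through a character of `hT`
    have htriv : ∀ u : WeilGroup.inertia F, (u : WeilGroup F) ∈ U → t u = 1 := fun u hu => by
      by_contra h
      exact hne ⟨u, hu, h⟩
    have hker : ∀ u ∈ U, ρ.toWeilGroupHom u = 1 := by
      intro u hu
      have h := h2 ⟨u, hU hu⟩ hu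
      rw [htriv ⟨u, hU hu⟩ hu] at h
      simp only [toAdd_one, zero_smul, IsNilpotent.exp_zero] at h
      exact Units.ext h
    obtain ⟨t', u₀, hu₀, ht'⟩ := hT F ℓ hℓ U hU hUo
    have hRlin : ∀ w, FramedRep.toRepresentation ρW w =
        Matrix.toLin' ((ρ.toWeilGroupHom w : GL (Fin n) (PadicAlgCl ℓ)) :
          Matrix (Fin n) (Fin n) (PadicAlgCl ℓ)) := fun w =>
      LinearMap.ext fun v => by rw [Matrix.toLin'_apply, FramedRep.toRepresentation_apply_apply]; rfl
    have hRc : WeilGroup.IsContinuousRep (FramedRep.toRepresentation ρW) :=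
      ⟨U, hU, hUo, fun u hu => by
        rw [FramedRep.toRepresentation_apply_eq_one_iff]
        exact hker u hu⟩
    refine ⟨WeilDeligneRep.ofRep (FramedRep.toRepresentation ρW) hRc, ?_⟩
    refine IsWeilDeligneOfLadic.of_N_eq_zero _ _ (WeilDeligneRep.ofRep_N _ _) t' U hU hUo
      ⟨u₀, hu₀, ht'⟩ hker Φ hΦ fun m u => ?_
    rw [WeilDeligneRep.ofRep_ρ, hRlin, LinearMap.toMatrix'_toLin']

end Summit.Langlands.Langlands.Theorems.IrreducibleOffSector.SquareIntegrablePlace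

end
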